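import Summits.QuantumFields.YangMills.Theorems.UnitScaleTiltHistoryTailBoundedHeight
import Summits.QuantumFields.YangMills.Theorems.UnitScaleTiltHistoryTailPerPlaquetteV3b
import Mathlib.Probability.Moments.Basic
import HarnessLib

/-!
# crux-ideate 1/2 on stmt-QuantumFields-18916 → live crux stmt-QuantumFields-19936 `HistoryTailL` — gen-4 sketch (SORRY-FREE)

Seat `ym-cruxidea-18916-1` (planner, ideator 1 of 2), gen 4, 2026-08-27.  Target of this generation: the DATUM-FREE joint bound that is the single
load-bearing stub of the OWNER's frame skeleton `Cruxes/HistoryTailL/Lines/birth_v5q.lean` (sha16 49ed60284f46d339) and the conclusion of the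
lead's line `birth_v5p3.lean` (323a7c7339aa1cc4, STUBs 2′+2″+2‴+4a ⇒ it; 4b landed p497206, 4c proved p497276):

  STUB A `stub_jointRateHigh` :  Gibbs_K(∀ q ∈ S, θBal(K−j) ≤ |Ū^j(∂q) − 1|) ≤ exp(−p_j²/4·|S| + C·x_j·N_j³)   (S `ccol·x_j^{r₀}`-separated).

This file is the typed part of card **`multiscale-relative-convexity-herbst`** (pub `ym-cruxidea-18916-1/cards/`): STUB A's text is copied VERBATIM as
the Prop `JointRateHigh` (nothing of v5q/v5p3 is imported, so no dependence on a sorried module) and TWO EXPONENTIAL-MOMENT SOCKETS are kernel-checked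
to imply it.  An engine that never mentions the event `⋂_{q∈S} E_q`, histories, or a rate constant closes STUB A through either socket.

§2 **Capped-quarter socket** — `jointRateHigh_of_cappedMgf : JointCappedMgf → JointRateHigh`.  Chernoff at tilt `t = ¼` EXACTLY on the CAPPED family
   energy `Y_S := Σ_{q∈S} min(X_q, p_j²)`, `X_q := β_{K−j}|Ū^j(∂q) − 1|²`: on the bad event `Y_S = p_j²|S|`, so `Gibbs_K(bad_S) ≤ e^{−p_j²|S|/4}·E_K e^{¼Y_S}`
   and STUB A follows from ANY merely-extensive bound `E_K e^{¼Y_S} ≤ e^{C x_j N_j³}`.  The typed rate `/4` and slack `x_j N_j³` ARE «Chernoff at ¼» and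
   «Gaussian phase costs O(1) per member»; the cap makes `e^{¼Y_S} ≤ e^{p_j²|S|/4}` a BOUNDED weight (repairs the far-tail dead end of gen-3 card F).  This
   socket is matched to Bałaban's (71) constant and is also usable by the (α)-lane (sacrifice `¼X_q` from (41)'s main term at scale j; LF-collar members
   paid cube-by-cube at break-even) — recorded on the card as the lane variant, not claimed as new since v5p3 STUB 4c landed.

§3 **Sub-Gaussian socket** — `jointRateHigh_of_subGaussian : JointSubGaussian → JointRateHigh`.  If the family deviation `Σ_{q∈S}(|Ū^j(∂q) − 1| − ½θ_j)` is
   SUB-GAUSSIAN with variance proxy `q·g_j²` per member, `q ≤ ½`, up to the extensive slack — the natural output of a Brascamp–Lieb/Bakry–Émery–Herbst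
   argument RELATIVE TO THE FREE MAXWELL FORM on the multiscale-regular stratum (card H's engine; free value `q_j ∈ [0.236, 0.281]`, kit j263093) — then
   STUB A holds with margin: rate `p_j²/(8q) ≥ p_j²/4` (room factor ≈ 1.8 for the `(1−ε)⁻¹` convexity loss and the `S²`-net loss).

§0 is generic probability (joint capped Chernoff; sub-Gaussian Chernoff); §1 repeats the gen-3 objects `badEv/pAmp/plaqX` (pub `SketchG3.lean`, tree
`Cruxes/HistoryTail/IdeaTiltInterpolationG3.lean`) so that the file is self-contained.  No `sorry`: the engines are hypotheses (`def … : Prop`).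
-/

open MeasureTheory ProbabilityTheory
open Literature.MathematicalPhysics.QuantumFieldTheory.Balaban1983to89
open Literature.MathematicalPhysics.QuantumFieldTheory.Balaban1983to89.T3ContinuumYM3Torus
open Literature.MathematicalPhysics.QuantumFieldTheory.Balaban1983to89.T3UnitScaleTilt
open Literature.MathematicalPhysics.QuantumFieldTheory.Balaban1983to89.T3UnitLawDensityEML
open Literature.MathematicalPhysics.QuantumFieldTheory.Balaban1983to89.T3BareTailProfile
open Literature.MathematicalPhysics.QuantumFieldTheory.Balaban1983to89.Missing (measurable_plaqHol)
open Literature.MathematicalPhysics.QuantumFieldTheory.Balaban1983to89.T4Continuum (measurable_iter)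
open Summit.QuantumFields.YangMills.Theorems

namespace Summit.QuantumFields.YangMills.Cruxes.HistoryTailL.IdeasG4

/-! ## §0 Generic probability -/

section Generic

variable {Ω ι : Type*} [MeasurableSpace Ω] {μ : Measure Ω} [IsFiniteMeasure μ]

/-- **Joint capped Chernoff.**  For real random variables `X_i`, a level `P`, a finite family `S` and a tilt `t ≥ 0`:
`μ{∀ i ∈ S, P ≤ X_i} ≤ e^{−t·P·|S|} · ∫ exp(t · Σ_{i∈S} min(X_i, P)) dμ` — on the joint event the capped sum equals `P·|S|`. -/
theorem measureReal_forall_le_le_capped_mgf (S : Finset ι) (X : ι → Ω → ℝ) (hX : ∀ i, Measurable (X i))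
    (P t : ℝ) (ht : 0 ≤ t) :
    μ.real {ω | ∀ i ∈ S, P ≤ X i ω} ≤
      Real.exp (-(t * (P * S.card))) * ∫ ω, Real.exp (t * ∑ i ∈ S, min (X i ω) P) ∂μ := by
  set Y : Ω → ℝ := fun ω => ∑ i ∈ S, min (X i ω) P with hY
  have hYm : Measurable Y := Finset.measurable_sum S fun i _ => (hX i).min measurable_const
  have hYle : ∀ ω, Y ω ≤ P * S.card := fun ω => by
    calc Y ω = ∑ i ∈ S, min (X i ω) P := rfl
      _ ≤ ∑ i ∈ S, P := Finset.sum_le_sum fun i _ => min_le_right _ _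
      _ = P * S.card := by rw [Finset.sum_const, nsmul_eq_mul, mul_comm]
  have hYi : Integrable (fun ω => Real.exp (t * Y ω)) μ :=
    integrable_exp_mul_of_le t (P * S.card) ht hYm.aemeasurable (Filter.Eventually.of_forall hYle)
  have hsub : {ω | ∀ i ∈ S, P ≤ X i ω} ⊆ {ω | P * S.card ≤ Y ω} := by
    intro ω hω
    simp only [Set.mem_setOf_eq] at hω ⊢
    have : Y ω = ∑ i ∈ S, P := Finset.sum_congr rfl fun i hi => min_eq_right (hω i hi)
    rw [this, Finset.sum_const, nsmul_eq_mul, mul_comm]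
  calc μ.real {ω | ∀ i ∈ S, P ≤ X i ω} ≤ μ.real {ω | P * S.card ≤ Y ω} := measureReal_mono hsub
    _ ≤ Real.exp (-t * (P * S.card)) * mgf Y μ t := measure_ge_le_exp_mul_mgf _ ht hYi
    _ = Real.exp (-(t * (P * S.card))) * ∫ ω, Real.exp (t * ∑ i ∈ S, min (X i ω) P) ∂μ := by
        rw [neg_mul]; rfl

/-- **Sub-Gaussian Chernoff (the output shape of a Herbst / Brascamp–Lieb argument).**  If the exponential moment of `Y` at the tilt
`s = r/σ²` is at most `e^{s²σ²/2 + B}`, then `μ{r ≤ Y} ≤ e^{−r²/(2σ²) + B}`. -/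
theorem measureReal_ge_le_of_subGaussian {Y : Ω → ℝ} (hY : Measurable Y) {r σ2 B b : ℝ} (hσ : 0 < σ2) (hr : 0 ≤ r)
    (hb : ∀ ω, Y ω ≤ b)
    (hmgf : ∫ ω, Real.exp ((r / σ2) * Y ω) ∂μ ≤ Real.exp ((r / σ2) ^ 2 * σ2 / 2 + B)) :
    μ.real {ω | r ≤ Y ω} ≤ Real.exp (-(r ^ 2 / (2 * σ2)) + B) := by
  have hs0 : 0 ≤ r / σ2 := div_nonneg hr hσ.le
  have hYi : Integrable (fun ω => Real.exp ((r / σ2) * Y ω)) μ :=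
    integrable_exp_mul_of_le (r / σ2) b hs0 hY.aemeasurable (Filter.Eventually.of_forall hb)
  have h1 := measure_ge_le_exp_mul_mgf (μ := μ) (X := Y) r hs0 hYi
  have hmgf' : mgf Y μ (r / σ2) ≤ Real.exp ((r / σ2) ^ 2 * σ2 / 2 + B) := hmgf
  have hexp : -(r / σ2) * r + ((r / σ2) ^ 2 * σ2 / 2 + B) = -(r ^ 2 / (2 * σ2)) + B := by
    field_simp; ring
  calc μ.real {ω | r ≤ Y ω} ≤ Real.exp (-(r / σ2) * r) * mgf Y μ (r / σ2) := h1
    _ ≤ Real.exp (-(r / σ2) * r) * Real.exp ((r / σ2) ^ 2 * σ2 / 2 + B) :=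
        mul_le_mul_of_nonneg_left hmgf' (Real.exp_nonneg _)
    _ = Real.exp (-(r ^ 2 / (2 * σ2)) + B) := by rw [← Real.exp_add, hexp]

end Generic

/-! ## §1 Objects (verbatim from gen 3) -/

section Objects

/-- The structure group. -/
abbrev SU2 := Matrix.specialUnitaryGroup (Fin 2) ℂ

variable (F : T3Family)

/-- The height-`j` BAD-PLAQUETTE EVENT of run `K` at `p ∈ T^{(j)}`. -/
def badEv (γ b₀ p₀ : ℝ) (K j : ℕ) (p : Plaq (F.P K) j) : Set (GaugeField (F.P K) 0 SU2) :=
  {U | θBal F.L γ b₀ p₀ (K - j) ≤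
    GaugeGroup.dist1 (GaugeField.plaqHol (Averaging.iter (fun _ => BlockAveraging.blockAvg ℰp) j U) p)}

/-- Bałaban's large-field amplitude at height `j` of run `K`: `p_{K−j} = pFun b₀ p₀ (√(γ L^{-(K−j)}))`. -/
noncomputable def pAmp (γ b₀ p₀ : ℝ) (K j : ℕ) : ℝ :=
  B10.pFun b₀ p₀ (Real.sqrt (γ * ((F.L : ℝ)⁻¹) ^ (K - j)))

/-- The running coupling `g_{K−j} = √(γ L^{-(K−j)})` of height `K − j`. -/
noncomputable def gRun (γ : ℝ) (K j : ℕ) : ℝ := Real.sqrt (γ * ((F.L : ℝ)⁻¹) ^ (K - j))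

/-- The deviation `d_q^{(j)}(U) = |Ū^{j}(∂q) − 1|` (operator norm) of the `j`-averaged plaquette. -/
noncomputable def plaqDev (K j : ℕ) (p : Plaq (F.P K) j) (U : GaugeField (F.P K) 0 SU2) : ℝ :=
  GaugeGroup.dist1 (GaugeField.plaqHol (Averaging.iter (fun _ => BlockAveraging.blockAvg ℰp) j U) p)

/-- The RUNNING-UNIT PLAQUETTE ENERGY `X_p^{(j)}(U) = β_{K−j} · |Ū^{j}(∂p) − 1|²`. -/
noncomputable def plaqX (γ : ℝ) (K j : ℕ) (p : Plaq (F.P K) j) (U : GaugeField (F.P K) 0 SU2) : ℝ :=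
  (F.scheme ℰp γ).β (K - j) * plaqDev F K j p U ^ 2

theorem measurable_plaqDev (K j : ℕ) (p : Plaq (F.P K) j) : Measurable (plaqDev F K j p) :=
  (RegularGaugeGroup.measurable_dist1.comp (measurable_plaqHol p)).comp
    (measurable_iter _ (F.avgMeasurable_of_measurableE ℰp measurableE_ℰp K) j)

theorem measurable_plaqX (γ : ℝ) (K j : ℕ) (p : Plaq (F.P K) j) : Measurable (plaqX F γ K j p) :=
  ((measurable_plaqDev F K j p).pow_const 2).const_mul _

theorem plaqDev_nonneg (K j : ℕ) (p : Plaq (F.P K) j) (U : GaugeField (F.P K) 0 SU2) : 0 ≤ plaqDev F K j p U := by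
  unfold plaqDev; exact GaugeGroup.dist1_nonneg _

/-- `d ≤ 2√2` on `SU(2)` ((11): `dist1² ≤ 2N(1 − reTr)`, `reTr ≥ −1`). -/
theorem plaqDev_le (K j : ℕ) (p : Plaq (F.P K) j) (U : GaugeField (F.P K) 0 SU2) : plaqDev F K j p U ≤ 3 := by
  set W := GaugeField.plaqHol (Averaging.iter (fun _ => BlockAveraging.blockAvg ℰp) j U) p
  have h11 := B10Eq71TorusLocal.dist1_sq_le_specialUnitaryGroup (N := 2) W
  have hre := RegularGaugeGroup.neg_one_le_reTr W
  have hd : 0 ≤ GaugeGroup.dist1 W := GaugeGroup.dist1_nonneg _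
  have h8 : GaugeGroup.dist1 W ^ 2 ≤ 8 := by
    have : ((2 : ℕ) : ℝ) = 2 := by norm_num
    rw [this] at h11
    nlinarith
  show GaugeGroup.dist1 W ≤ 3
  nlinarith

/-- The bad event is a super-level set of `X_p^{(j)}`: `θBal(K−j) ≤ d ⇒ p_{K−j}² ≤ X_p^{(j)}` (`θBal = g·p(g)`, `β = g⁻²`). -/
theorem badEv_subset_plaqX {γ : ℝ} (hγ : 0 < γ) (hγ1 : γ ≤ 1) {b₀ : ℝ} (hb₀ : 0 ≤ b₀) (p₀ : ℝ) (K j : ℕ)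
    (p : Plaq (F.P K) j) :
    badEv F γ b₀ p₀ K j p ⊆ {U | pAmp F γ b₀ p₀ K j ^ 2 ≤ plaqX F γ K j p U} := by
  intro U hU
  simp only [badEv, Set.mem_setOf_eq, θBal] at hU
  simp only [Set.mem_setOf_eq, plaqX, plaqDev, pAmp]
  set x := γ * ((F.L : ℝ)⁻¹) ^ (K - j) with hx_def
  set d := GaugeGroup.dist1 (GaugeField.plaqHol (Averaging.iter (fun _ => BlockAveraging.blockAvg ℰp) j U) p)
  set P := B10.pFun b₀ p₀ (Real.sqrt x)
  have hL1 : 1 ≤ F.L := F.hL.2.le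
  obtain ⟨hg0, hg1⟩ := T3ThresholdSmallness.sqrt_coupling_pos_le hL1 hγ (K - j)
  have hg1' : Real.sqrt x ≤ 1 := hg1.trans (Real.sqrt_le_one.mpr hγ1)
  have hx : 0 < x := by
    have hL' : (0 : ℝ) < F.L := by exact_mod_cast (lt_trans zero_lt_one F.hL.2)
    exact mul_pos hγ (pow_pos (inv_pos.mpr hL') _)
  have hP : 0 ≤ P := B10.pFun_nonneg b₀ p₀ _ hb₀ hg0 hg1'
  have hβ : (F.scheme ℰp γ).β (K - j) = x⁻¹ := rfl
  have hsq : x * P ^ 2 ≤ d ^ 2 := by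
    have h1 : (Real.sqrt x * P) ^ 2 ≤ d ^ 2 := pow_le_pow_left₀ (mul_nonneg hg0.le hP) hU 2
    rw [mul_pow, Real.sq_sqrt hx.le] at h1
    exact h1
  rw [hβ, inv_mul_eq_div, le_div_iff₀ hx]
  calc P ^ 2 * x = x * P ^ 2 := mul_comm _ _
    _ ≤ d ^ 2 := hsq

/-- The bad event in deviation form: `θBal = g · pAmp ≤ d`. -/
theorem badEv_iff_dev (γ b₀ p₀ : ℝ) (K j : ℕ) (p : Plaq (F.P K) j) (U : GaugeField (F.P K) 0 SU2) :
    U ∈ badEv F γ b₀ p₀ K j p ↔ gRun F γ K j * pAmp F γ b₀ p₀ K j ≤ plaqDev F K j p U := by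
  simp only [badEv, Set.mem_setOf_eq, θBal, gRun, pAmp, plaqDev]

end Objects


/-! ## §2 Capped-quarter socket: STUB A ⟸ an extensive bound on the CAPPED quarter exponential moment of the family energy -/

section CardG

/-- The separation hypothesis of v5q STUB A (verbatim): members of `S` are `ccol·x_j^{r₀}` apart in the torus distance of their source sites. -/
def Separated (F : T3Family) (γ ccol r₀ : ℝ) (K j : ℕ) (S : Finset (Plaq (F.P K) j)) : Prop :=
  ∀ q ∈ S, ∀ q' ∈ S, q ≠ q' →
    ccol * (1 + Real.log (Real.sqrt (γ * ((F.L : ℝ)⁻¹) ^ (K - j)))⁻¹) ^ r₀ ≤ (Site.tdist q.src q'.src : ℝ)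

/-- **STUB A of `birth_v5q.lean` (sha16 49ed60284f46d339), VERBATIM as a Prop** (`Separated` unfolds to the stub's hypothesis by `rfl`). -/
def JointRateHigh : Prop :=
  ∀ (L : ℕ), Odd L → 7 ≤ L →
    ∃ r₀ b₀ p₀ ccol C γ₁ : ℝ, 0 ≤ r₀ ∧ 0 < b₀ ∧ 2 < p₀ ∧ 1 + 3 * r₀ / 2 < p₀ ∧ 1 ≤ ccol ∧ 0 ≤ C ∧ 0 < γ₁ ∧ γ₁ ≤ 1 ∧
      ∀ (F : T3Family) (γ : ℝ), F.L = L → 0 < γ → γ ≤ γ₁ →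
        ∃ j₀ : ℕ, ∀ (K j : ℕ), j₀ < j → j ≤ K → ∀ S : Finset (Plaq (F.P K) j),
          (∀ q ∈ S, ∀ q' ∈ S, q ≠ q' →
            ccol * (1 + Real.log (Real.sqrt (γ * ((F.L : ℝ)⁻¹) ^ (K - j)))⁻¹) ^ r₀ ≤ (Site.tdist q.src q'.src : ℝ)) →
          (gibbsK F ℰp γ K).real
              {U | ∀ q ∈ S, θBal F.L γ b₀ p₀ (K - j) ≤
                GaugeGroup.dist1 (GaugeField.plaqHol
                  (Averaging.iter (fun _ => BlockAveraging.blockAvg ℰp) j U) q)} ≤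
            Real.exp (-(B10.pFun b₀ p₀ (Real.sqrt (γ * ((F.L : ℝ)⁻¹) ^ (K - j))) ^ 2 / 4) * (S.card : ℝ) +
              C * (1 + Real.log (Real.sqrt (γ * ((F.L : ℝ)⁻¹) ^ (K - j)))⁻¹) * ((F.P K).sitesPerDir j : ℝ) ^ 3)

/-- **Socket §2 hypothesis `JointCappedMgf` (the CAPPED QUARTER-MGF, merely extensive).**  Same quantifier prefix as STUB A; conclusion: for every
separated family `S` of level-`j` plaquettes,
`E_K exp(¼ · Σ_{q∈S} min(X_q^{(j)}, p_j²)) ≤ exp(C · x_j · N_j³)`,  `X_q^{(j)} = β_{K−j}|Ū^j(∂q) − 1|²`, `x_j = 1 + log g_j⁻¹`, `N_j = sitesPerDir j`.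
Why `¼` and why a cap: Chernoff at `t = ¼` turns the typed rate `p_j²/4` per member into an identity; the cap `min(·, p_j²)` (harmless on the bad
event, where it is attained) bounds the weight by `e^{p_j²/4}` per member, so inside a large-field cube of the (α)-lane run at profile `b_lane > b₀`
it costs less than that cube's own (71)-factor `e^{−p_j(b_lane)²/4}`, while in clean territory `¼X_q ≤` (plaquette `q`'s own term of the height-`j` main
action) is SACRIFICED (positivity of the remaining action, `∫ e^{−A'} dHaar ≤ 1`): the whole bound is «upper envelope (41) with its main term kept + history
mass (v5p3 STUB 4a at profile b_lane) + `Z_K ≥ e^{−C_L x N³}` (STUB 4b)», the slack `x_j N_j³` being exactly the price of NOT running the RG past scale `j`. -/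
def JointCappedMgf : Prop :=
  ∀ (L : ℕ), Odd L → 7 ≤ L →
    ∃ r₀ b₀ p₀ ccol C γ₁ : ℝ, 0 ≤ r₀ ∧ 0 < b₀ ∧ 2 < p₀ ∧ 1 + 3 * r₀ / 2 < p₀ ∧ 1 ≤ ccol ∧ 0 ≤ C ∧ 0 < γ₁ ∧ γ₁ ≤ 1 ∧
      ∀ (F : T3Family) (γ : ℝ), F.L = L → 0 < γ → γ ≤ γ₁ →
        ∃ j₀ : ℕ, ∀ (K j : ℕ), j₀ < j → j ≤ K → ∀ S : Finset (Plaq (F.P K) j), Separated F γ ccol r₀ K j S →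
          ∫ U, Real.exp ((1 / 4 : ℝ) * ∑ q ∈ S, min (plaqX F γ K j q U) (pAmp F γ b₀ p₀ K j ^ 2)) ∂(gibbsK F ℰp γ K) ≤
            Real.exp (C * (1 + Real.log (Real.sqrt (γ * ((F.L : ℝ)⁻¹) ^ (K - j)))⁻¹) * ((F.P K).sitesPerDir j : ℝ) ^ 3)

/-- **Socket §2 (PROVED): `JointCappedMgf → JointRateHigh`** — STUB A of v5q from the capped quarter-mgf bound, by the joint capped Chernoff at `t = ¼`. -/
theorem jointRateHigh_of_cappedMgf (h : JointCappedMgf) : JointRateHigh := by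
  intro L hLo h7
  obtain ⟨r₀, b₀, p₀, ccol, C, γ₁, hr₀, hb, hp2, hp, hccol, hC, hγ₁, hγ₁1, hG⟩ := h L hLo h7
  refine ⟨r₀, b₀, p₀, ccol, C, γ₁, hr₀, hb, hp2, hp, hccol, hC, hγ₁, hγ₁1, fun F γ hFL hγ hle => ?_⟩
  obtain ⟨j₀, hGF⟩ := hG F γ hFL hγ hle
  refine ⟨j₀, fun K j hj hjK S hS => ?_⟩
  have hγ1 : γ ≤ 1 := hle.trans hγ₁1
  haveI := isProbabilityMeasure_gibbsK F ℰp hγ.le K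
  have hmgf := hGF K j hj hjK S hS
  have hsub :
      {U : GaugeField (F.P K) 0 SU2 | ∀ q ∈ S, θBal F.L γ b₀ p₀ (K - j) ≤
          GaugeGroup.dist1 (GaugeField.plaqHol (Averaging.iter (fun _ => BlockAveraging.blockAvg ℰp) j U) q)} ⊆
        {U | ∀ q ∈ S, pAmp F γ b₀ p₀ K j ^ 2 ≤ plaqX F γ K j q U} := by
    intro U hU q hq
    exact badEv_subset_plaqX F hγ hγ1 hb.le p₀ K j q (hU q hq)
  have hch := measureReal_forall_le_le_capped_mgf (μ := gibbsK F ℰp γ K) S (fun q => plaqX F γ K j q)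
    (fun q => measurable_plaqX F γ K j q) (pAmp F γ b₀ p₀ K j ^ 2) (1 / 4 : ℝ) (by norm_num)
  calc (gibbsK F ℰp γ K).real
          {U | ∀ q ∈ S, θBal F.L γ b₀ p₀ (K - j) ≤
            GaugeGroup.dist1 (GaugeField.plaqHol (Averaging.iter (fun _ => BlockAveraging.blockAvg ℰp) j U) q)}
        ≤ (gibbsK F ℰp γ K).real {U | ∀ q ∈ S, pAmp F γ b₀ p₀ K j ^ 2 ≤ plaqX F γ K j q U} := measureReal_mono hsub
    _ ≤ Real.exp (-((1 / 4 : ℝ) * (pAmp F γ b₀ p₀ K j ^ 2 * S.card))) *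
          ∫ U, Real.exp ((1 / 4 : ℝ) * ∑ q ∈ S, min (plaqX F γ K j q U) (pAmp F γ b₀ p₀ K j ^ 2)) ∂(gibbsK F ℰp γ K) := hch
    _ ≤ Real.exp (-((1 / 4 : ℝ) * (pAmp F γ b₀ p₀ K j ^ 2 * S.card))) *
          Real.exp (C * (1 + Real.log (Real.sqrt (γ * ((F.L : ℝ)⁻¹) ^ (K - j)))⁻¹) * ((F.P K).sitesPerDir j : ℝ) ^ 3) :=
        mul_le_mul_of_nonneg_left hmgf (Real.exp_nonneg _)
    _ = Real.exp (-(B10.pFun b₀ p₀ (Real.sqrt (γ * ((F.L : ℝ)⁻¹) ^ (K - j))) ^ 2 / 4) * (S.card : ℝ) +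
          C * (1 + Real.log (Real.sqrt (γ * ((F.L : ℝ)⁻¹) ^ (K - j)))⁻¹) * ((F.P K).sitesPerDir j : ℝ) ^ 3) := by
        rw [← Real.exp_add]; congr 1; unfold pAmp; ring

end CardG

/-! ## §3 Sub-Gaussian socket (card `multiscale-relative-convexity-herbst`): STUB A ⟸ a sub-Gaussian law of the family deviation relative to the free variance -/

section CardH

/-- **Socket §3 hypothesis `JointSubGaussian` (Herbst output relative to the free Maxwell form).**  Same prefix as STUB A plus a variance factor
`q ∈ (0, ½]`; conclusion: for every separated family `S` and every tilt `s ≥ 0`,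
`E_K exp(s · Σ_{q∈S}(d_q − ½θ_j)) ≤ exp(s²·|S|·q·g_j²/2 + C x_j N_j³)`,  `d_q = |Ū^j(∂q) − 1|`, `θ_j = θBal(K−j) = g_j p_j`.
Reading: the family deviation is sub-Gaussian about (at most) HALF the threshold with variance proxy `q g_j²` per member — what Bakry–Émery/Herbst gives
for a `(1−ε)`-log-concave-RELATIVE-TO-`β_K Q₀` measure and a functional whose free variance is `q_free g_j²` (calibrated `q_free ≤ 0.281`, j263093),
the `½θ_j` absorbing the worst clean-boundary forcing and `C x N³` the blame-pushing / sector bookkeeping. -/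
def JointSubGaussian : Prop :=
  ∀ (L : ℕ), Odd L → 7 ≤ L →
    ∃ r₀ b₀ p₀ ccol C γ₁ q : ℝ, 0 ≤ r₀ ∧ 0 < b₀ ∧ 2 < p₀ ∧ 1 + 3 * r₀ / 2 < p₀ ∧ 1 ≤ ccol ∧ 0 ≤ C ∧ 0 < γ₁ ∧ γ₁ ≤ 1 ∧
      0 < q ∧ q ≤ 1 / 2 ∧
      ∀ (F : T3Family) (γ : ℝ), F.L = L → 0 < γ → γ ≤ γ₁ →
        ∃ j₀ : ℕ, ∀ (K j : ℕ), j₀ < j → j ≤ K → ∀ S : Finset (Plaq (F.P K) j), Separated F γ ccol r₀ K j S →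
          ∀ s : ℝ, 0 ≤ s →
            ∫ U, Real.exp (s * (∑ q' ∈ S, (plaqDev F K j q' U - gRun F γ K j * pAmp F γ b₀ p₀ K j / 2))) ∂(gibbsK F ℰp γ K) ≤
              Real.exp (s ^ 2 * ((S.card : ℝ) * (q * gRun F γ K j ^ 2)) / 2 +
                C * (1 + Real.log (Real.sqrt (γ * ((F.L : ℝ)⁻¹) ^ (K - j)))⁻¹) * ((F.P K).sitesPerDir j : ℝ) ^ 3)

/-- **Socket §3 (PROVED): `JointSubGaussian → JointRateHigh`** — rate `p_j²/(8q) ≥ p_j²/4` per member since `q ≤ ½`. -/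
theorem jointRateHigh_of_subGaussian (h : JointSubGaussian) : JointRateHigh := by
  intro L hLo h7
  obtain ⟨r₀, b₀, p₀, ccol, C, γ₁, q, hr₀, hb, hp2, hp, hccol, hC, hγ₁, hγ₁1, hq0, hq, hG⟩ := h L hLo h7
  refine ⟨r₀, b₀, p₀, ccol, C, γ₁, hr₀, hb, hp2, hp, hccol, hC, hγ₁, hγ₁1, fun F γ hFL hγ hle => ?_⟩
  obtain ⟨j₀, hGF⟩ := hG F γ hFL hγ hle
  refine ⟨j₀, fun K j hj hjK S hS => ?_⟩
  have hγ1 : γ ≤ 1 := hle.trans hγ₁1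
  haveI := isProbabilityMeasure_gibbsK F ℰp hγ.le K
  have hL1 : 1 ≤ F.L := F.hL.2.le
  obtain ⟨hg0, hg1⟩ := T3ThresholdSmallness.sqrt_coupling_pos_le hL1 hγ (K - j)
  have hg1' : gRun F γ K j ≤ 1 := hg1.trans (Real.sqrt_le_one.mpr hγ1)
  have hg0' : 0 < gRun F γ K j := hg0
  have hP0 : 0 ≤ pAmp F γ b₀ p₀ K j := B10.pFun_nonneg b₀ p₀ _ hb.le hg0 hg1'
  -- abbreviations (plain `have`-level names would hide definitional content; we keep the terms explicit and name only numerals)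
  have hn0 : (0 : ℝ) ≤ (S.card : ℝ) := by positivity
  have hx0 : 0 ≤ 1 + Real.log (Real.sqrt (γ * ((F.L : ℝ)⁻¹) ^ (K - j)))⁻¹ := by
    have : 0 ≤ Real.log (Real.sqrt (γ * ((F.L : ℝ)⁻¹) ^ (K - j)))⁻¹ :=
      Real.log_nonneg ((one_le_inv_iff₀).mpr ⟨hg0, hg1'⟩)
    linarith
  have hB0 : 0 ≤ C * (1 + Real.log (Real.sqrt (γ * ((F.L : ℝ)⁻¹) ^ (K - j)))⁻¹) * ((F.P K).sitesPerDir j : ℝ) ^ 3 := by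
    positivity
  -- the family deviation `Y = Σ_{q∈S} (d_q − g·P/2)` is bounded and measurable
  have hYm : Measurable (fun U : GaugeField (F.P K) 0 SU2 =>
      ∑ q' ∈ S, (plaqDev F K j q' U - gRun F γ K j * pAmp F γ b₀ p₀ K j / 2)) :=
    Finset.measurable_sum S fun q' _ => (measurable_plaqDev F K j q').sub measurable_const
  have hYb : ∀ U : GaugeField (F.P K) 0 SU2,
      ∑ q' ∈ S, (plaqDev F K j q' U - gRun F γ K j * pAmp F γ b₀ p₀ K j / 2) ≤ 3 * (S.card : ℝ) := fun U => by
    calc ∑ q' ∈ S, (plaqDev F K j q' U - gRun F γ K j * pAmp F γ b₀ p₀ K j / 2)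
          ≤ ∑ q' ∈ S, (3 : ℝ) := Finset.sum_le_sum fun q' _ => by
            have h3 := plaqDev_le F K j q' U
            have : 0 ≤ gRun F γ K j * pAmp F γ b₀ p₀ K j / 2 := by positivity
            linarith
      _ = 3 * (S.card : ℝ) := by rw [Finset.sum_const, nsmul_eq_mul, mul_comm]
  -- `bad_S ⊆ {n·gP/2 ≤ Y}` since `θBal = g·P ≤ d_q` for every member
  have hsub :
      {U : GaugeField (F.P K) 0 SU2 | ∀ q' ∈ S, θBal F.L γ b₀ p₀ (K - j) ≤
          GaugeGroup.dist1 (GaugeField.plaqHol (Averaging.iter (fun _ => BlockAveraging.blockAvg ℰp) j U) q')} ⊆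
        {U | (S.card : ℝ) * (gRun F γ K j * pAmp F γ b₀ p₀ K j / 2) ≤
          ∑ q' ∈ S, (plaqDev F K j q' U - gRun F γ K j * pAmp F γ b₀ p₀ K j / 2)} := by
    intro U hU
    simp only [Set.mem_setOf_eq] at hU ⊢
    have hmem : ∀ q' ∈ S, gRun F γ K j * pAmp F γ b₀ p₀ K j ≤ plaqDev F K j q' U := fun q' hq' =>
      (badEv_iff_dev F γ b₀ p₀ K j q' U).mp (hU q' hq')
    calc (S.card : ℝ) * (gRun F γ K j * pAmp F γ b₀ p₀ K j / 2)
          = ∑ q' ∈ S, (gRun F γ K j * pAmp F γ b₀ p₀ K j - gRun F γ K j * pAmp F γ b₀ p₀ K j / 2) := by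
            rw [Finset.sum_const, nsmul_eq_mul]; ring
      _ ≤ _ := Finset.sum_le_sum fun q' hq' => by linarith [hmem q' hq']
  -- the empty family: event = everything, bound ≥ 1
  rcases Nat.eq_zero_or_pos S.card with hS0 | hSpos
  · have hS : S = ∅ := Finset.card_eq_zero.mp hS0
    subst hS
    calc (gibbsK F ℰp γ K).real {U : GaugeField (F.P K) 0 SU2 | ∀ q' ∈ (∅ : Finset (Plaq (F.P K) j)),
            θBal F.L γ b₀ p₀ (K - j) ≤
              GaugeGroup.dist1 (GaugeField.plaqHol (Averaging.iter (fun _ => BlockAveraging.blockAvg ℰp) j U) q')}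
          ≤ (gibbsK F ℰp γ K).real Set.univ := measureReal_mono (Set.subset_univ _)
      _ = 1 := by simp
      _ = Real.exp 0 := Real.exp_zero.symm
      _ ≤ _ := Real.exp_le_exp.mpr (by simp only [Finset.card_empty, Nat.cast_zero, mul_zero, zero_add]; exact hB0)
  have hnpos : (0 : ℝ) < (S.card : ℝ) := by exact_mod_cast hSpos
  -- Chernoff at `s = r/σ²`, `r = n·gP/2`, `σ² = n·q·g²`
  have hσ : 0 < (S.card : ℝ) * (q * gRun F γ K j ^ 2) := by positivity
  have hr : 0 ≤ (S.card : ℝ) * (gRun F γ K j * pAmp F γ b₀ p₀ K j / 2) := by positivity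
  have hmgf := hGF K j hj hjK S hS
    (((S.card : ℝ) * (gRun F γ K j * pAmp F γ b₀ p₀ K j / 2)) / ((S.card : ℝ) * (q * gRun F γ K j ^ 2)))
    (div_nonneg hr hσ.le)
  have htail := measureReal_ge_le_of_subGaussian (μ := gibbsK F ℰp γ K) hYm
    (r := (S.card : ℝ) * (gRun F γ K j * pAmp F γ b₀ p₀ K j / 2))
    (σ2 := (S.card : ℝ) * (q * gRun F γ K j ^ 2))
    (B := C * (1 + Real.log (Real.sqrt (γ * ((F.L : ℝ)⁻¹) ^ (K - j)))⁻¹) * ((F.P K).sitesPerDir j : ℝ) ^ 3)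
    (b := 3 * (S.card : ℝ)) hσ hr hYb hmgf
  -- the rate: `(n gP/2)² / (2 n q g²) = n P²/(8q) ≥ n P²/4`
  have hrate :
      -(((S.card : ℝ) * (gRun F γ K j * pAmp F γ b₀ p₀ K j / 2)) ^ 2 / (2 * ((S.card : ℝ) * (q * gRun F γ K j ^ 2))))
        ≤ -(pAmp F γ b₀ p₀ K j ^ 2 / 4) * (S.card : ℝ) := by
    have hg2 : 0 < gRun F γ K j ^ 2 := by positivity
    have key : ((S.card : ℝ) * (gRun F γ K j * pAmp F γ b₀ p₀ K j / 2)) ^ 2 / (2 * ((S.card : ℝ) * (q * gRun F γ K j ^ 2)))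
        = (S.card : ℝ) * pAmp F γ b₀ p₀ K j ^ 2 / (8 * q) := by
      field_simp; ring
    rw [key, neg_mul, neg_le_neg_iff, le_div_iff₀ (by positivity)]
    have h2q : 2 * q ≤ 1 := by linarith
    calc pAmp F γ b₀ p₀ K j ^ 2 / 4 * (S.card : ℝ) * (8 * q)
          = ((S.card : ℝ) * pAmp F γ b₀ p₀ K j ^ 2) * (2 * q) := by ring
      _ ≤ ((S.card : ℝ) * pAmp F γ b₀ p₀ K j ^ 2) * 1 := mul_le_mul_of_nonneg_left h2q (by positivity)
      _ = (S.card : ℝ) * pAmp F γ b₀ p₀ K j ^ 2 := mul_one _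
  calc (gibbsK F ℰp γ K).real {U | ∀ q' ∈ S, θBal F.L γ b₀ p₀ (K - j) ≤
            GaugeGroup.dist1 (GaugeField.plaqHol (Averaging.iter (fun _ => BlockAveraging.blockAvg ℰp) j U) q')}
        ≤ (gibbsK F ℰp γ K).real {U | (S.card : ℝ) * (gRun F γ K j * pAmp F γ b₀ p₀ K j / 2) ≤
            ∑ q' ∈ S, (plaqDev F K j q' U - gRun F γ K j * pAmp F γ b₀ p₀ K j / 2)} := measureReal_mono hsub
    _ ≤ _ := htail
    _ ≤ Real.exp (-(pAmp F γ b₀ p₀ K j ^ 2 / 4) * (S.card : ℝ) +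
          C * (1 + Real.log (Real.sqrt (γ * ((F.L : ℝ)⁻¹) ^ (K - j)))⁻¹) * ((F.P K).sitesPerDir j : ℝ) ^ 3) :=
        Real.exp_le_exp.mpr (by linarith [hrate])
    _ = _ := by unfold pAmp; rfl

end CardH

end Summit.QuantumFields.YangMills.Cruxes.HistoryTailL.IdeasG4
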